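import Mathlib.Analysis.InnerProductSpace.PiL2
import Mathlib.Geometry.Manifold.Instances.Real
import Mathlib.Analysis.SpecialFunctions.Pow.Real
import Mathlib.Analysis.SpecialFunctions.Sqrt
import Literature.Geometry.Lorentzian.Basic
import Literature.Geometry.Lorentzian.LorentzianMetric
import Literature.Geometry.Lorentzian.LeviCivita
import HarnessLib

-- D-0014 migration p3238 (prover-migrate-pool-B-0) + review revisions 1–2 of reviewer-rev-pool-g2-4 (Kerr.Facts as an instance-argument Prop class; cite locators) applied by the operator sorry-sweep 2026-08-13
-- provenance: harness21/H21/H21/Prelude/Lorentz/KerrSchild.lean @ e16a486 (interim HEAD d8f2665); M5 mechanical rewrite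
/-!
# Kerr–Schild algebra; the Kerr / Schwarzschild / Minkowski spacetimes (trunk G08, item C15)

Family `gr`, notion `kerr_schwarzschild_family`, statement id **gr.S17** (definition role).

We realise the Kerr family `g_{M,a}` explicitly, in *ingoing Kerr–Schild Cartesian coordinates*
`(t*, x, y, z)` on open subsets of `E4 = EuclideanSpace ℝ (Fin 4)` (index `0` is `t*`, see
`Basic.lean`), in the Kerr–Schild form
`g = η + 2H ℓ ⊗ ℓ`, `H = M r³ / (r⁴ + a² z²)`,
`ℓ = (1, (r x + a y)/(r² + a²), (r y − a x)/(r² + a²), z/r)`,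
where `r = Kerr.radius a` is the positive root of `r⁴ − (x² + y² + z² − a²) r² − a² z² = 0`
(Kerr, PRL 11 (1963) eq. (5); Kerr–Schild 1965; Visser, *The Kerr spacetime: a brief
introduction*, arXiv:0706.0622, (32)–(35); Dafermos–Rodnianski, arXiv:0811.0354, §5.1).
The covector `ℓ` is `η`-null wherever `r > 0`, so `g` is Lorentzian with inverse
`g⁻¹ = η⁻¹ − 2H ℓ♯ ⊗ ℓ♯` for **every** value of `H`; better, `g = A^* η` for the shear
`A v = v + H ℓ(v) ℓ♯` (`Kerr.ksMap`), which gives the Lorentzian signature of `g` for all real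
parameters `M, a, r₀`. The analytic/topological facts not proved here (connectedness of the chart
domain, analyticity of the sections `x ↦ g(x)`, `x ↦ V(x)`) are vendored as named facts (D-0014)
and bundled in `Kerr.Facts`, a `Prop` class taken as the instance hypothesis `[Kerr.Facts]` by `Kerr.metric`,
`Kerr.timeOrientation`, `Kerr.spacetime`, `Kerr.exteriorSpacetime`,
`Schwarzschild.exteriorSpacetime`; Ricci-flatness and the Killing property of `∂_{t*}`, `∂_φ` are
the named facts `Kerr.isRicciFlat` (stated as `∀ x, Ric_x = 0`, the unfolding of
`PseudoRiemannianMetric.IsRicciFlat`, to avoid importing `Einstein.lean`),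
`Kerr.isKillingField_stationaryField`, `Kerr.isKillingField_axialField`.

Contents:
* `Minkowski.bilin` (η), `Minkowski.metric : LorentzianMetric 𝓘(ℝ, E4) ω E4`,
  `Minkowski.timeOrientation` (`∂ₜ`), `Minkowski.spacetime : Spacetime 4`;
* `Kerr.radius`, `Kerr.rPlus`, `Kerr.rMinus`, `Kerr.IsSubextremal`, `Kerr.IsExtremal`,
  `Kerr.scalarH`, `Kerr.nullCovector`, `Kerr.bilin`;
* regions parametrised by an inner radius `r₀`: `Kerr.region a r₀ = {max r₀ 0 < r}` (an
  `Opens E4`), `Kerr.exterior M a = Kerr.region a r₊`, `Kerr.blackHoleInterior`,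
  `Kerr.ergoregion`;
* `Kerr.Facts` (named facts, D-0014), `Kerr.metric M a r₀ : LorentzianMetric 𝓘(ℝ, E4) ω (Kerr.region a r₀)`,
  `Kerr.timeOrientation` (the vector field `−g♯(dt*)`, needs `0 ≤ M`), `Kerr.spacetime`,
  `Kerr.exteriorSpacetime`, `Schwarzschild.exteriorSpacetime` (**gr.S17**);
* `Kerr.isRicciFlat`, the Killing fields `Kerr.stationaryField = ∂_{t*}` and
  `Kerr.axialField = x ∂_y − y ∂_x`.

## Mathlib

Mathlib has no Minkowski/Kerr/Schwarzschild metric as a (pseudo-)Riemannian structure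
(`rg -i 'schwarzschild|kerr metric|minkowski metric' Mathlib` finds only Minkowski functionals of
convex geometry and `Mathlib/Analysis/InnerProductSpace` material). We use `EuclideanSpace.proj`,
`EuclideanSpace.single`, `ContinuousLinearMap.smulRight` (for `α ⊗ β`),
`TopologicalSpace.Opens` as open submanifolds, and `contMDiff_vectorSpace_iff_contDiff`.

## Design choices

* Regularity: the Kerr–Schild components are real-analytic on `{r > 0}`, so the metrics are built
  at `n = ω`; the bundled `Spacetime 4` (which is `C^∞` by definition) is obtained through the
  regularity-lowering maps `LorentzianMetric.ofLE`, `TimeOrientation.ofLE` defined here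
  (dot-notation extensions of our own structures, mirroring `PseudoRiemannianMetric.ofLE`).
* `Kerr.region a r₀ := {x | max r₀ 0 < Kerr.radius a x}` for an arbitrary inner radius `r₀`
  (review F5/F15): `r₀ = r₊` gives the domain of outer communications, `r₀ < r₊` gives
  horizon-penetrating charts. It is nonempty and connected for all `a, r₀`.
* The time orientation is `V = −g♯(dt*) = (1 + 2H, −2H ℓ¹, −2H ℓ², −2H ℓ³)` with
  `g(V, V) = −1 − 2H`; timelike iff `H > −1/2`, guaranteed on all of `{r > 0}` iff `0 ≤ M`, whence
  the hypothesis `hM : 0 ≤ M` (for `M < 0`, `H → −∞` as `r → 0⁺` along the axis).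
* **Puncture.** For `M = a = 0`, `Kerr.radius 0 x = ‖x⃗‖` and `Kerr.exterior 0 0` is `E4` minus
  the time axis, not Minkowski space; Minkowski space proper is `Minkowski.spacetime`.
* Junk values: `Kerr.rPlus M a = Kerr.rMinus M a = M` for `|a| > M` (`Real.sqrt` of a negative
  number is `0`); `Kerr.nullCovector a x` has last component `z / r = 0` when `r = 0` (never used:
  all regions lie in `{r > 0}`).

## References

* R. P. Kerr, *Gravitational field of a spinning mass as an example of algebraically special
  metrics*, Phys. Rev. Lett. 11 (1963) 237–238.
* R. P. Kerr, A. Schild, *Some algebraically degenerate solutions of Einstein's gravitational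
  field equations*, Proc. Symp. Appl. Math. 17 (1965) 199.
* M. Visser, *The Kerr spacetime: a brief introduction*, arXiv:0706.0622, §5, (32)–(35).
* B. O'Neill, *The geometry of Kerr black holes*, A K Peters 1995, Ch. 2.
* M. Dafermos, I. Rodnianski, *Lectures on black holes and linear waves*, arXiv:0811.0354, §5.1.
-/

noncomputable section

open Bundle TopologicalSpace
open scoped Manifold ContDiff Topology

namespace Literature.Geometry.Lorentzian

/-! ### Lowering the regularity of Lorentzian metrics and time orientations -/

section OfLE

variable {E : Type*} [NormedAddCommGroup E] [NormedSpace ℝ E] {H : Type*} [TopologicalSpace H]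
  {I : ModelWithCorners ℝ E H} {n n' : ℕ∞ω} {M : Type*} [TopologicalSpace M] [ChartedSpace H M]
  [IsManifold I ∞ M]

/-- A `C^n` Lorentzian metric is in particular a `C^{n'}` Lorentzian metric for `n' ≤ n`
(dot-notation extension of `Literature.Geometry.Lorentzian.LorentzianMetric`, mirroring
`PseudoRiemannianMetric.ofLE` and Mathlib's `Bundle.IsContMDiffRiemannianBundle.of_le`).
O'Neill 1983, Ch. 3, Def. 3.1. [cite: ONeill1983, Ch. 3  Def. 3.1] -/
def LorentzianMetric.ofLE (g : LorentzianMetric I n M) (h : n' ≤ n) : LorentzianMetric I n' M where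
  toPseudoRiemannianMetric := g.toPseudoRiemannianMetric.ofLE h
  exists_timelike := g.exists_timelike
  pos_of_orthogonal := g.pos_of_orthogonal

/-- `ofLE` does not change the metric (O'Neill 1983, Ch. 3, Def. 3.1). [cite: ONeill1983, Ch. 3  Def. 3.1] -/
@[simp]
lemma LorentzianMetric.val_ofLE (g : LorentzianMetric I n M) (h : n' ≤ n) :
    (g.ofLE h).val = g.val := rfl

/-- A `C^n` time orientation of `g` is a `C^{n'}` time orientation of `g.ofLE h` for `n' ≤ n`
(dot-notation extension of `Literature.Geometry.Lorentzian.TimeOrientation`). O'Neill 1983, Ch. 5, Lemma 5.32. [cite: ONeill1983, Ch. 5  Lemma 5.32] -/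
def TimeOrientation.ofLE {g : LorentzianMetric I n M} (τ : TimeOrientation g) (h : n' ≤ n) :
    TimeOrientation (g.ofLE h) where
  vectorField := τ.vectorField
  isTimelike := τ.isTimelike
  contMDiff := τ.contMDiff.of_le h

/-- `ofLE` does not change the orienting vector field (O'Neill 1983, Ch. 5, Lemma 5.32). [cite: ONeill1983, Ch. 5  Lemma 5.32] -/
@[simp]
lemma TimeOrientation.vectorField_ofLE {g : LorentzianMetric I n M} (τ : TimeOrientation g)
    (h : n' ≤ n) : (τ.ofLE h).vectorField = τ.vectorField := rfl

end OfLE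

/-! ### Covectors and rank-one bilinear forms on `E4` -/

namespace E4

/-- The coordinate covector `dx^μ : E4 →L[ℝ] ℝ`, `v ↦ v μ` (Mathlib's `EuclideanSpace.proj μ`;
`dx⁰ = dt*`). Dafermos–Rodnianski, arXiv:0811.0354, §5.1. [cite: arXiv08110354] -/
abbrev dx (μ : Fin 4) : E4 →L[ℝ] ℝ := EuclideanSpace.proj μ

/-- The covector with components `c : Fin 4 → ℝ`, i.e. `∑ μ, c μ dx^μ : E4 →L[ℝ] ℝ`
(coordinate expression of a one-form; Visser arXiv:0706.0622, (34)). [cite: arXiv07060622] -/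
def covector (c : Fin 4 → ℝ) : E4 →L[ℝ] ℝ := ∑ μ, c μ • dx μ

/-- `(∑ μ, c μ dx^μ) v = ∑ μ, c μ v μ` (Visser arXiv:0706.0622, (34)). [cite: arXiv07060622] -/
@[simp]
theorem covector_apply (c : Fin 4 → ℝ) (v : E4) : covector c v = ∑ μ, c μ * v μ := by
  simp [covector]

/-- The tensor product `α ⊗ β` of two covectors as a continuous bilinear form
`(v, w) ↦ α v * β w` (Mathlib's `ContinuousLinearMap.smulRight`). Kerr–Schild 1965 (the
rank-one term `ℓ ⊗ ℓ`). [cite: KerrSchild1965, (the rank-one term  ℓ ⊗ ℓ] -/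
def tmul (α β : E4 →L[ℝ] ℝ) : E4 →L[ℝ] E4 →L[ℝ] ℝ := α.smulRight β

/-- `(α ⊗ β)(v, w) = α v * β w` (Kerr–Schild 1965). [cite: KerrSchild1965] -/
@[simp]
theorem tmul_apply (α β : E4 →L[ℝ] ℝ) (v w : E4) : tmul α β v w = α v * β w := by
  simp [tmul]

/-- The coordinate vector `∂_μ ∈ E4` (Mathlib's `EuclideanSpace.single μ 1`; `∂₀ = ∂_{t*}`).
Dafermos–Rodnianski, arXiv:0811.0354, §5.1. [cite: arXiv08110354] -/
abbrev basisVector (μ : Fin 4) : E4 := EuclideanSpace.single μ 1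

/-- `‖x⃗‖² = x₁² + x₂² + x₃²` for the spatial radius of a point of `E4` (Dafermos–Rodnianski,
arXiv:0811.0354, §5.1). [cite: arXiv08110354, §5.1] -/
theorem spatialNorm_sq (x : E4) : spatialNorm x ^ 2 = x 1 ^ 2 + x 2 ^ 2 + x 3 ^ 2 := by
  rw [spatialNorm, EuclideanSpace.real_norm_sq_eq]
  simp [Fin.sum_univ_three]

end E4

/-! ### Minkowski space -/

namespace Minkowski

/-- The **Minkowski bilinear form** `η(v, w) = −v⁰ w⁰ + v¹ w¹ + v² w² + v³ w³` on `E4`, as a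
continuous bilinear form `−dt ⊗ dt + ∑ᵢ dxⁱ ⊗ dxⁱ`. O'Neill 1983, Ch. 3, p. 55 (`ℝ⁴₁`);
Hawking–Ellis 1973, §5.1. [cite: ONeill1983, Ch. 3  p. 55 ( ℝ⁴₁] -/
def bilin : E4 →L[ℝ] E4 →L[ℝ] ℝ :=
  E4.tmul (-E4.dx 0) (E4.dx 0) + ∑ i : Fin 3, E4.tmul (E4.dx i.succ) (E4.dx i.succ)

/-- `η(v, w) = −v⁰ w⁰ + ∑ᵢ vⁱ wⁱ` (O'Neill 1983, Ch. 3, p. 55). [cite: ONeill1983, Ch. 3  p. 55] -/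
@[simp]
theorem bilin_apply (v w : E4) :
    bilin v w = -(v 0 * w 0) + ∑ i : Fin 3, v i.succ * w i.succ := by
  simp [bilin]

/-- `η` is symmetric (O'Neill 1983, Ch. 3, p. 55). [cite: ONeill1983, Ch. 3  p. 55] -/
theorem bilin_symm (v w : E4) : bilin v w = bilin w v := by
  simp [mul_comm]

/-- `η(∂ₜ, ∂ₜ) = −1`: the time axis is timelike (O'Neill 1983, Ch. 3, p. 55). Not a `simp`
lemma: `simp` already proves it via `bilin_apply`. [cite: ONeill1983, Ch. 3  p. 55] -/
theorem bilin_basisVector_zero : bilin (E4.basisVector 0) (E4.basisVector 0) = -1 := by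
  simp [Fin.succ_ne_zero]

/-- `η` is nondegenerate (O'Neill 1983, Ch. 3, p. 55: `ℝ⁴₁` is a scalar product space). [cite: ONeill1983, Ch. 3  p. 55:  ℝ⁴₁  is a scalar product] -/
theorem bilin_nondegenerate (v : E4) (hv : ∀ w, bilin v w = 0) : v = 0 := by
  ext μ
  have h := hv (E4.basisVector μ)
  fin_cases μ <;> simp [Fin.sum_univ_three, Fin.succ_ne_zero] at h ⊢ <;> simpa using h

/-- The `η`-orthogonal complement of a timelike vector is spacelike (O'Neill 1983, Ch. 5,
Lemma 5.26 for `ℝ⁴₁`). [cite: ONeill1983, Ch. 5  Lemma 5.26 for  ℝ⁴₁] -/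
theorem bilin_pos_of_orthogonal (v w : E4) (hv : bilin v v < 0) (hvw : bilin v w = 0)
    (hw : w ≠ 0) : 0 < bilin w w := by
  simp only [bilin_apply] at hv hvw ⊢
  have hcs := Finset.sum_mul_sq_le_sq_mul_sq Finset.univ (fun i : Fin 3 ↦ v i.succ)
    (fun i ↦ w i.succ)
  simp only [pow_two] at hcs
  have hsw : 0 ≤ ∑ i : Fin 3, w i.succ * w i.succ :=
    Finset.sum_nonneg fun i _ ↦ mul_self_nonneg _
  have hsv : 0 ≤ ∑ i : Fin 3, v i.succ * v i.succ :=
    Finset.sum_nonneg fun i _ ↦ mul_self_nonneg _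
  have heq : ∑ i : Fin 3, v i.succ * w i.succ = v 0 * w 0 := by linarith
  rw [heq] at hcs
  rcases hsw.eq_or_lt with hsw0 | hswpos
  · exfalso
    apply hw
    have hwi : ∀ i : Fin 3, w i.succ = 0 := fun i ↦
      mul_self_eq_zero.1 <| (Finset.sum_eq_zero_iff_of_nonneg
        (fun j _ ↦ mul_self_nonneg (w (Fin.succ j)))).1 hsw0.symm i (Finset.mem_univ _)
    have h0 : v 0 * w 0 = 0 := by
      rw [← heq]
      exact Finset.sum_eq_zero fun i _ ↦ by simp [hwi]
    have hv0 : v 0 ≠ 0 := by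
      intro h
      rw [h] at hv
      linarith
    have hw0 : w 0 = 0 := by simpa [hv0] using h0
    ext μ
    refine Fin.cases ?_ (fun i ↦ ?_) μ
    · simpa using hw0
    · simpa using hwi i
  · nlinarith [hcs, sq_nonneg (v 0), sq_nonneg (w 0)]

/-- `η(∂ₜ, w) = −w⁰` (O'Neill 1983, Ch. 3, p. 55). [cite: ONeill1983, Ch. 3  p. 55] -/
theorem bilin_basisVector_zero_left (w : E4) : bilin (E4.basisVector 0) w = -w 0 := by
  simp [Fin.succ_ne_zero]

/-- The constant section `x ↦ η` of the bundle of bilinear forms on `T E4` is analytic (a constant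
section of a trivial bundle; O'Neill 1983, Ch. 3, p. 55). [cite: ONeill1983, Ch. 3  p. 55] -/
theorem contMDiff_bilin :
    ContMDiff 𝓘(ℝ, E4) (𝓘(ℝ, E4).prod 𝓘(ℝ, E4 →L[ℝ] E4 →L[ℝ] ℝ)) ω
      (fun x : E4 ↦ TotalSpace.mk' (E4 →L[ℝ] E4 →L[ℝ] ℝ)
        (E := fun y : E4 ↦ TangentSpace 𝓘(ℝ, E4) y →L[ℝ] TangentSpace 𝓘(ℝ, E4) y →L[ℝ] ℝ)
        x bilin) := by
  intro x
  rw [contMDiffAt_section]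
  convert! contMDiffAt_const (c := bilin)
  ext v w
  rw [hom_trivializationAt_apply]
  simp only [ContinuousLinearMap.inCoordinates]
  simp [-bilin_apply]
  rw [hom_trivializationAt_apply]
  simp [-bilin_apply, ContinuousLinearMap.inCoordinates]
  rfl

/-- **Minkowski space** `ℝ⁴₁` as an analytic Lorentzian metric on `E4`: the constant section
`x ↦ η`. O'Neill 1983, Ch. 3, p. 55 and Ch. 5, Ex. 5.1; Hawking–Ellis 1973, §5.1. [cite: ONeill1983, Ch. 3  p. 55 and Ch. 5  Ex. 5.1] -/
def metric : LorentzianMetric 𝓘(ℝ, E4) ω E4 where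
  val _ := bilin
  symm _ := bilin_symm
  nondegenerate _ := bilin_nondegenerate
  contMDiff := contMDiff_bilin
  exists_timelike _ := ⟨E4.basisVector 0, bilin_basisVector_zero.trans_lt neg_one_lt_zero⟩
  pos_of_orthogonal _ := bilin_pos_of_orthogonal

/-- The metric of Minkowski space at any point is `η` (O'Neill 1983, Ch. 3, p. 55). [cite: ONeill1983, Ch. 3  p. 55] -/
@[simp]
theorem metric_val (x : E4) : metric.val x = bilin := rfl

/-- The standard **time orientation** `∂ₜ = ∂_{t*}` of Minkowski space (a constant, hence
analytic, timelike vector field). Hawking–Ellis 1973, §5.1; O'Neill 1983, Ch. 5, p. 145. [cite: HawkingEllis1973, §5.1] -/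
def timeOrientation : TimeOrientation metric where
  vectorField _ := E4.basisVector 0
  isTimelike _ := bilin_basisVector_zero.trans_lt neg_one_lt_zero
  contMDiff := contMDiff_vectorSpace_iff_contDiff.mpr contDiff_const

/-- **gr.S17** (Minkowski space; Hawking–Ellis 1973 §5.1, O'Neill 1983 Ch. 5 Ex. 5.1).
**Minkowski spacetime** `(ℝ⁴, η)` with the time orientation `∂ₜ`, as a bundled `Spacetime 4`
with carrier `E4`. [cite: HawkingEllis1973, §5.1  O'Neill 1983 Ch. 5 Ex. 5.1] -/
def spacetime : Spacetime 4 where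
  carrier := E4
  metric := metric.ofLE le_top
  timeOrientation := timeOrientation.ofLE le_top

end Minkowski

/-! ### Kerr–Schild algebra -/

namespace Kerr

/-- The **Kerr–Schild radius** `r(a, x)`: the nonnegative root of
`r⁴ − (ρ² − a²) r² − a² z² = 0`, `ρ² = x₁² + x₂² + x₃²`, `z = x₃`, i.e.
`r = √( ((ρ² − a²) + √((ρ² − a²)² + 4 a² z²)) / 2 )`. It is continuous on `E4`, positive and
real-analytic off the closed disc `{z = 0, ρ ≤ |a|}`, and equals `‖x⃗‖` for `a = 0`.
Kerr, PRL 11 (1963), text after eq. (5); Visser arXiv:0706.0622, (35). [cite: arXiv07060622] -/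
def radius (a : ℝ) (x : E4) : ℝ :=
  √(((E4.spatialNorm x ^ 2 - a ^ 2) + √((E4.spatialNorm x ^ 2 - a ^ 2) ^ 2 + 4 * a ^ 2 * x 3 ^ 2))
    / 2)

/-- The Kerr–Schild radius is nonnegative (it is a square root). Visser arXiv:0706.0622, (35). [cite: arXiv07060622] -/
theorem radius_nonneg (a : ℝ) (x : E4) : 0 ≤ radius a x := Real.sqrt_nonneg _

/-- The Kerr–Schild radius is continuous on all of `E4` (composition of polynomials and square
roots). Visser arXiv:0706.0622, (35). [cite: arXiv07060622] -/
theorem continuous_radius (a : ℝ) : Continuous (radius a) := by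
  unfold radius E4.spatialNorm
  fun_prop

/-- The discriminant `(ρ² − a²)² + 4 a² z²` under the inner square root of the Kerr–Schild
radius is nonnegative (Visser arXiv:0706.0622, (35)). [cite: arXiv07060622, (35)] -/
theorem radius_discr_nonneg (a : ℝ) (x : E4) :
    0 ≤ (E4.spatialNorm x ^ 2 - a ^ 2) ^ 2 + 4 * a ^ 2 * x 3 ^ 2 := by positivity

/-- `|ρ² − a²| ≤ √((ρ² − a²)² + 4 a² z²)`, so the radicand of the Kerr–Schild radius is
nonnegative (Visser arXiv:0706.0622, (35)). [cite: arXiv07060622, (35)] -/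
theorem abs_le_sqrt_radius_discr (a : ℝ) (x : E4) :
    |E4.spatialNorm x ^ 2 - a ^ 2| ≤ √((E4.spatialNorm x ^ 2 - a ^ 2) ^ 2 + 4 * a ^ 2 * x 3 ^ 2) :=
  (Real.sqrt_sq_eq_abs _).symm.le.trans <| Real.sqrt_le_sqrt (by nlinarith [sq_nonneg (a * x 3)])

/-- `r² = ((ρ² − a²) + √((ρ² − a²)² + 4 a² z²)) / 2`: the square of the Kerr–Schild radius
(Visser arXiv:0706.0622, (35)). [cite: arXiv07060622, (35)] -/
theorem radius_sq (a : ℝ) (x : E4) :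
    radius a x ^ 2 = ((E4.spatialNorm x ^ 2 - a ^ 2) +
      √((E4.spatialNorm x ^ 2 - a ^ 2) ^ 2 + 4 * a ^ 2 * x 3 ^ 2)) / 2 := by
  unfold radius
  rw [Real.sq_sqrt]
  linarith [abs_le_sqrt_radius_discr a x, neg_abs_le (E4.spatialNorm x ^ 2 - a ^ 2)]

/-- The defining quartic `r⁴ − (ρ² − a²) r² − a² z² = 0` of the Kerr–Schild radius.
Kerr, PRL 11 (1963); Visser arXiv:0706.0622, (35). [cite: arXiv07060622] -/
theorem radius_quartic (a : ℝ) (x : E4) :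
    radius a x ^ 4 - (E4.spatialNorm x ^ 2 - a ^ 2) * radius a x ^ 2 - a ^ 2 * x 3 ^ 2 = 0 := by
  rw [show radius a x ^ 4 = (radius a x ^ 2) ^ 2 by ring, radius_sq]
  linear_combination (1 / 4 : ℝ) * Real.sq_sqrt (radius_discr_nonneg a x)

/-- For `a = 0` the Kerr–Schild radius is the Euclidean spatial radius `‖x⃗‖` (Schwarzschild in
ingoing Eddington–Finkelstein/Kerr–Schild form; Dafermos–Rodnianski arXiv:0811.0354, §5.1). [cite: arXiv08110354] -/
theorem radius_zero_left (x : E4) : radius 0 x = E4.spatialNorm x := by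
  have h := E4.spatialNorm_nonneg x
  unfold radius
  rw [show (E4.spatialNorm x ^ 2 - 0 ^ 2) ^ 2 + 4 * 0 ^ 2 * x 3 ^ 2 = (E4.spatialNorm x ^ 2) ^ 2
    by ring, Real.sqrt_sq (by positivity), show (E4.spatialNorm x ^ 2 - 0 ^ 2 +
    E4.spatialNorm x ^ 2) / 2 = E4.spatialNorm x ^ 2 by ring, Real.sqrt_sq h]

/-- The **outer (event) horizon radius** `r₊ = M + √(M² − a²)`. Junk value: for `|a| > M` the
square root vanishes and `r₊ = M`. O'Neill 1995, Ch. 2, §2.3; Dafermos–Rodnianski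
arXiv:0811.0354, §5.1. [cite: ONeill1995, Ch. 2  §2.3] -/
def rPlus (M a : ℝ) : ℝ := M + √(M ^ 2 - a ^ 2)

/-- The **inner (Cauchy) horizon radius** `r₋ = M − √(M² − a²)`. Junk value: for `|a| > M` the
square root vanishes and `r₋ = M`. O'Neill 1995, Ch. 2, §2.3. [cite: ONeill1995, Ch. 2  §2.3] -/
def rMinus (M a : ℝ) : ℝ := M - √(M ^ 2 - a ^ 2)

/-- `r₋ ≤ r₊` (O'Neill 1995, Ch. 2, §2.3). [cite: ONeill1995, Ch. 2  §2.3] -/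
theorem rMinus_le_rPlus (M a : ℝ) : rMinus M a ≤ rPlus M a := by
  unfold rMinus rPlus
  linarith [Real.sqrt_nonneg (M ^ 2 - a ^ 2)]

/-- `r₊ = 2M` for `a = 0` and `0 ≤ M` (the Schwarzschild radius; O'Neill 1995, Ch. 2, §2.3). [cite: ONeill1995, Ch. 2  §2.3] -/
theorem rPlus_zero_right {M : ℝ} (hM : 0 ≤ M) : rPlus M 0 = 2 * M := by
  simp [rPlus, Real.sqrt_sq hM, two_mul]

/-- The Kerr parameters `(M, a)` are **subextremal** if `|a| < M` (two distinct horizons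
`r₋ < r₊`). O'Neill 1995, Ch. 2, §2.3 ("slowly rotating"); Dafermos–Rodnianski
arXiv:0811.0354, §5.1. [cite: ONeill1995, Ch. 2  §2.3 ("slowly rotating"] -/
def IsSubextremal (M a : ℝ) : Prop := |a| < M

/-- The Kerr parameters `(M, a)` are **extremal** if `|a| = M > 0` (`r₋ = r₊ = M`).
O'Neill 1995, Ch. 2, §2.3. [cite: ONeill1995, Ch. 2  §2.3] -/
def IsExtremal (M a : ℝ) : Prop := |a| = M ∧ 0 < M

/-- Subextremal parameters have positive mass (O'Neill 1995, Ch. 2, §2.3). [cite: ONeill1995, Ch. 2  §2.3] -/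
theorem IsSubextremal.pos {M a : ℝ} (h : IsSubextremal M a) : 0 < M :=
  (abs_nonneg a).trans_lt h

/-- For subextremal parameters the horizon radii are distinct: `r₋ < r₊`
(O'Neill 1995, Ch. 2, §2.3). [cite: ONeill1995, Ch. 2  §2.3] -/
theorem IsSubextremal.rMinus_lt_rPlus {M a : ℝ} (h : IsSubextremal M a) :
    rMinus M a < rPlus M a := by
  have ha : a ^ 2 < M ^ 2 := sq_lt_sq' (abs_lt.1 h).1 (abs_lt.1 h).2
  have hs := Real.sqrt_pos.2 (sub_pos.2 ha)
  unfold rMinus rPlus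
  linarith

/-- For subextremal parameters the Cauchy-horizon radius is nonnegative, `0 ≤ r₋` (with
`r₋ = 0` iff `a = 0`), since `√(M² − a²) ≤ M`. O'Neill 1995, Ch. 2, §2.3. [cite: ONeill1995, Ch. 2  §2.3] -/
theorem IsSubextremal.rMinus_nonneg {M a : ℝ} (h : IsSubextremal M a) : 0 ≤ rMinus M a := by
  have h1 : √(M ^ 2 - a ^ 2) ≤ √(M ^ 2) := Real.sqrt_le_sqrt (by nlinarith [sq_nonneg a])
  rw [Real.sqrt_sq h.pos.le] at h1
  unfold rMinus
  linarith

/-- The **Kerr–Schild scalar** `H = M r³ / (r⁴ + a² z²)` (so that `g = η + 2H ℓ ⊗ ℓ`; for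
`a = 0`, `H = M / r`). Kerr, PRL 11 (1963), eq. (5); Visser arXiv:0706.0622, (33). Junk value
`0` at `r = z = 0` (division by zero). [cite: arXiv07060622] -/
def scalarH (M a : ℝ) (x : E4) : ℝ :=
  M * radius a x ^ 3 / (radius a x ^ 4 + a ^ 2 * x 3 ^ 2)

/-- `H ≥ 0` for `M ≥ 0` (Visser arXiv:0706.0622, (33)). This is what makes `−g♯(dt*)`
timelike, see `Kerr.timeOrientation`. [cite: arXiv07060622] -/
theorem scalarH_nonneg {M : ℝ} (hM : 0 ≤ M) (a : ℝ) (x : E4) : 0 ≤ scalarH M a x := by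
  unfold scalarH
  have hr := radius_nonneg a x
  positivity

/-- The components `ℓ_μ` of the Kerr–Schild null covector:
`ℓ = (1, (r x₁ + a x₂)/(r² + a²), (r x₂ − a x₁)/(r² + a²), x₃/r)`.
Kerr, PRL 11 (1963), eq. (5); Visser arXiv:0706.0622, (34). [cite: arXiv07060622] -/
def nullCovectorFun (a : ℝ) (x : E4) : Fin 4 → ℝ :=
  ![1, (radius a x * x 1 + a * x 2) / (radius a x ^ 2 + a ^ 2),
    (radius a x * x 2 - a * x 1) / (radius a x ^ 2 + a ^ 2), x 3 / radius a x]

/-- The **Kerr–Schild null covector** `ℓ = ℓ_μ dx^μ : E4 →L[ℝ] ℝ` at the point `x`, with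
components `nullCovectorFun a x`. It is `η`-null wherever `r > 0`. Kerr, PRL 11 (1963), eq. (5);
Kerr–Schild 1965; Visser arXiv:0706.0622, (34). [cite: KerrSchild1965] -/
def nullCovector (a : ℝ) (x : E4) : E4 →L[ℝ] ℝ := E4.covector (nullCovectorFun a x)

/-- The `η`-dual vector `ℓ♯ = η⁻¹ ℓ = (−ℓ₀, ℓ₁, ℓ₂, ℓ₃)` of the null covector.
Kerr–Schild 1965; Visser arXiv:0706.0622, §5. [cite: KerrSchild1965] -/
def nullVector (a : ℝ) (x : E4) : E4 :=
  WithLp.toLp 2 fun μ ↦ if μ = 0 then -nullCovectorFun a x μ else nullCovectorFun a x μ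

/-- `ℓ♯` is `η`-dual to `ℓ`: `η(ℓ♯, w) = ℓ(w)` (Kerr–Schild 1965). [cite: KerrSchild1965] -/
theorem bilin_nullVector (a : ℝ) (x : E4) (w : E4) :
    Minkowski.bilin (nullVector a x) w = nullCovector a x w := by
  simp [nullVector, nullCovector, Fin.sum_univ_four, Fin.sum_univ_three]
  ring

/-- `η(w, ℓ♯) = ℓ(w)` (Kerr–Schild 1965; symmetric form of `bilin_nullVector`). [cite: KerrSchild1965] -/
theorem bilin_nullVector_right (a : ℝ) (x : E4) (w : E4) :
    Minkowski.bilin w (nullVector a x) = nullCovector a x w := by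
  rw [Minkowski.bilin_symm, bilin_nullVector]

/-- `ℓ(∂_{t*}) = ℓ₀ = 1` (Kerr–Schild 1965; Visser arXiv:0706.0622, (34)). [cite: arXiv07060622, (34)] -/
@[simp]
theorem nullCovector_basisVector_zero (a : ℝ) (x : E4) :
    nullCovector a x (E4.basisVector 0) = 1 := by
  simp [nullCovector, nullCovectorFun]

/-- `ℓ` is `η`-null wherever `r > 0`: `η(ℓ♯, ℓ♯) = ℓ(ℓ♯) = 0`, i.e.
`−1 + (x₁² + x₂²)/(r² + a²) + x₃²/r² = 0`, which is the defining quartic of `r`.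
Kerr–Schild 1965; Visser arXiv:0706.0622, (35). [cite: KerrSchild1965] -/
theorem nullCovector_nullVector {a : ℝ} {x : E4} (hx : 0 < radius a x) :
    nullCovector a x (nullVector a x) = 0 := by
  have hq := radius_quartic a x
  rw [E4.spatialNorm_sq] at hq
  simp only [nullCovector, nullVector, nullCovectorFun, E4.covector_apply, Fin.sum_univ_four,
    Fin.isValue, Matrix.cons_val_zero, Matrix.cons_val_one, Matrix.cons_val,
    if_true, one_ne_zero, if_false, Fin.reduceEq]
  set r := radius a x
  have h1 : r ^ 2 + a ^ 2 ≠ 0 := by positivity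
  have h2 : r ≠ 0 := hx.ne'
  field_simp
  linear_combination (-(r ^ 2 + a ^ 2)) * hq

/-- The **Kerr metric in Kerr–Schild form** at the point `x`:
`g_{M,a}(x) = η + 2 H(x) ℓ(x) ⊗ ℓ(x)` as a continuous bilinear form on `E4`.
Kerr, PRL 11 (1963), eq. (5); Kerr–Schild 1965; Visser arXiv:0706.0622, (32)–(35). For `a = 0`
this is the Schwarzschild metric in ingoing Eddington–Finkelstein (Kerr–Schild) coordinates,
for `M = 0` it is `η`. [cite: KerrSchild1965] -/
def bilin (M a : ℝ) (x : E4) : E4 →L[ℝ] E4 →L[ℝ] ℝ :=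
  Minkowski.bilin + (2 * scalarH M a x) • E4.tmul (nullCovector a x) (nullCovector a x)

/-- Unfolding lemma: `g(v, w) = η(v, w) + 2H ℓ(v) ℓ(w)` (Visser arXiv:0706.0622, (32)). [cite: arXiv07060622] -/
theorem bilin_apply (M a : ℝ) (x v w : E4) :
    bilin M a x v w =
      Minkowski.bilin v w + 2 * scalarH M a x * (nullCovector a x v * nullCovector a x w) := by
  simp [bilin, mul_assoc]

/-- For `M = 0` the Kerr–Schild metric is the Minkowski metric (Visser arXiv:0706.0622, (32)). [cite: arXiv07060622] -/
@[simp]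
theorem bilin_zero_left (a : ℝ) (x : E4) : bilin 0 a x = Minkowski.bilin :=
  ContinuousLinearMap.ext fun v ↦ ContinuousLinearMap.ext fun w ↦ by simp [bilin_apply, scalarH]

/-- The Kerr–Schild metric is symmetric (Kerr–Schild 1965). [cite: KerrSchild1965] -/
theorem bilin_symm (M a : ℝ) (x v w : E4) : bilin M a x v w = bilin M a x w v := by
  rw [bilin_apply, bilin_apply, Minkowski.bilin_symm, mul_comm (nullCovector a x v)]

/-- The Kerr–Schild metric is nondegenerate wherever `r > 0`, for **all** real `M, a`: since `ℓ`
is `η`-null, `g⁻¹ = η⁻¹ − 2H ℓ♯ ⊗ ℓ♯` is an explicit inverse. Kerr–Schild 1965, §2;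
Visser arXiv:0706.0622, §5. [cite: KerrSchild1965, §2] -/
theorem bilin_nondegenerate (M a : ℝ) {x : E4} (hx : 0 < radius a x) (v : E4)
    (hv : ∀ w, bilin M a x v w = 0) : v = 0 := by
  have hl : nullCovector a x v = 0 := by
    have := hv (nullVector a x)
    rwa [bilin_apply, bilin_nullVector_right, nullCovector_nullVector hx, mul_zero, mul_zero,
      add_zero] at this
  exact Minkowski.bilin_nondegenerate v fun w ↦ by
    have := hv w
    rwa [bilin_apply, hl, zero_mul, mul_zero, add_zero] at this

/-- The **Kerr–Schild shear** `A v = v + H ℓ(v) ℓ♯` at the point `x`: a linear automorphism of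
`E4` (inverse `v ↦ v − H ℓ(v) ℓ♯`, since `ℓ(ℓ♯) = 0`) with `g(v, w) = η(A v, A w)`, i.e.
`g = A^* η`; this exhibits the Lorentzian signature of every Kerr–Schild metric
`η + 2H ℓ ⊗ ℓ`, `ℓ` null. Kerr–Schild 1965, §2. [cite: KerrSchild1965, §2] -/
def ksMap (M a : ℝ) (x : E4) (v : E4) : E4 :=
  v + (scalarH M a x * nullCovector a x v) • nullVector a x

/-- `g(v, w) = η(A v, A w)` for the Kerr–Schild shear `A = Kerr.ksMap`, wherever `r > 0`
(Kerr–Schild 1965, §2). [cite: KerrSchild1965, §2] -/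
theorem bilin_eq_bilin_ksMap (M a : ℝ) {x : E4} (hx : 0 < radius a x) (v w : E4) :
    bilin M a x v w = Minkowski.bilin (ksMap M a x v) (ksMap M a x w) := by
  simp only [ksMap, map_add, map_smul, add_apply,
    FunLike.coe_smul, Pi.smul_apply, smul_eq_mul, bilin_nullVector,
    bilin_nullVector_right, nullCovector_nullVector hx, bilin_apply]
  ring

/-- `v ↦ v − H ℓ(v) ℓ♯` is a right inverse of the Kerr–Schild shear `A`, wherever `r > 0`
(Kerr–Schild 1965, §2). [cite: KerrSchild1965, §2] -/
theorem ksMap_sub_smul (M a : ℝ) {x : E4} (hx : 0 < radius a x) (v : E4) :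
    ksMap M a x (v - (scalarH M a x * nullCovector a x v) • nullVector a x) = v := by
  simp [ksMap, nullCovector_nullVector hx]

/-- The Kerr–Schild shear `A` is injective, wherever `r > 0` (Kerr–Schild 1965, §2). [cite: KerrSchild1965, §2] -/
theorem ksMap_eq_zero (M a : ℝ) {x : E4} (hx : 0 < radius a x) {v : E4}
    (hv : ksMap M a x v = 0) : v = 0 := by
  have hl : nullCovector a x v = 0 := by
    simpa [ksMap, nullCovector_nullVector hx] using congrArg (nullCovector a x) hv
  simpa [ksMap, hl] using hv

/-- The Kerr–Schild metric admits a timelike vector wherever `r > 0`, for all real `M, a`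
(a Kerr–Schild deformation of `η` along a null covector has Lorentzian signature).
Kerr–Schild 1965, §2. [cite: KerrSchild1965, §2] -/
theorem bilin_exists_timelike (M a : ℝ) {x : E4} (hx : 0 < radius a x) :
    ∃ v : E4, bilin M a x v v < 0 :=
  ⟨E4.basisVector 0 - (scalarH M a x * nullCovector a x (E4.basisVector 0)) • nullVector a x, by
    rw [bilin_eq_bilin_ksMap M a hx, ksMap_sub_smul M a hx]
    exact Minkowski.bilin_basisVector_zero.trans_lt neg_one_lt_zero⟩

/-- The `g`-orthogonal complement of a `g`-timelike vector is `g`-spacelike, wherever `r > 0`,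
for all real `M, a` (Lorentzian signature of Kerr–Schild metrics; Kerr–Schild 1965, §2;
O'Neill 1983, Ch. 5, Lemma 5.26). [cite: KerrSchild1965, §2] -/
theorem bilin_pos_of_orthogonal (M a : ℝ) {x : E4} (hx : 0 < radius a x) (v w : E4)
    (hv : bilin M a x v v < 0) (hvw : bilin M a x v w = 0) (hw : w ≠ 0) :
    0 < bilin M a x w w := by
  rw [bilin_eq_bilin_ksMap M a hx] at hv hvw ⊢
  exact Minkowski.bilin_pos_of_orthogonal _ _ hv hvw fun h ↦ hw (ksMap_eq_zero M a hx h)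

/-- The vector field `V = −g♯(dt*)`, in components
`V = (1 + 2H, −2H ℓ₁, −2H ℓ₂, −2H ℓ₃) = ∂_{t*} − 2H ℓ♯` (using `ℓ₀ = 1`). It satisfies
`g(V, ·) = −dt*` and `g(V, V) = g^{00} = −1 − 2H`. Dafermos–Rodnianski arXiv:0811.0354, §5.1
(`∇t*` is timelike on `{r > 0}` for `M ≥ 0`); Visser arXiv:0706.0622, §5. [cite: arXiv08110354] -/
def timeVector (M a : ℝ) (x : E4) : E4 :=
  E4.basisVector 0 - (2 * scalarH M a x) • nullVector a x

/-- `g(V, w) = −dt*(w) = −w⁰` for `V = Kerr.timeVector`, wherever `r > 0`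
(Dafermos–Rodnianski arXiv:0811.0354, §5.1). [cite: arXiv08110354] -/
theorem bilin_timeVector {M a : ℝ} {x : E4} (hx : 0 < radius a x) (w : E4) :
    bilin M a x (timeVector M a x) w = -w 0 := by
  simp only [timeVector, bilin_apply, map_sub, map_smul, sub_apply, FunLike.coe_smul,
    Pi.smul_apply, smul_eq_mul, bilin_nullVector,
    nullCovector_nullVector hx, nullCovector_basisVector_zero, Minkowski.bilin_basisVector_zero_left]
  ring

/-- `g(V, V) = −1 − 2H` for `V = Kerr.timeVector`, wherever `r > 0`
(Dafermos–Rodnianski arXiv:0811.0354, §5.1; Visser arXiv:0706.0622, §5: `g^{tt} = −1 − 2H`). [cite: arXiv08110354] -/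
theorem bilin_timeVector_timeVector {M a : ℝ} {x : E4} (hx : 0 < radius a x) :
    bilin M a x (timeVector M a x) (timeVector M a x) = -1 - 2 * scalarH M a x := by
  rw [bilin_timeVector hx]
  simp [timeVector, nullVector, nullCovectorFun]
  ring

/-- For `M ≥ 0` the vector `V = −g♯(dt*)` is timelike wherever `r > 0`
(Dafermos–Rodnianski arXiv:0811.0354, §5.1). [cite: arXiv08110354] -/
theorem bilin_timeVector_timeVector_neg {M : ℝ} (hM : 0 ≤ M) (a : ℝ) {x : E4}
    (hx : 0 < radius a x) : bilin M a x (timeVector M a x) (timeVector M a x) < 0 := by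
  rw [bilin_timeVector_timeVector hx]
  linarith [scalarH_nonneg hM a x]

/-! ### Regions of the Kerr–Schild chart -/

/-- The Kerr–Schild chart domain with **inner radius** `r₀`:
`Kerr.region a r₀ = {x ∈ E4 | max r₀ 0 < r(a, x)}`, an open subset of `E4` (hence a manifold
modelled on `𝓘(ℝ, E4) = 𝓡 4`). For `r₀ = r₊` this is the domain of outer communications, for
`r₀ < r₊` a horizon-penetrating neighbourhood of it; for `r₀ ≤ 0` it is `{r > 0}`, the
complement of the closed disc `{t* ∈ ℝ, z = 0, ρ ≤ |a|}`. Dafermos–Rodnianski arXiv:0811.0354,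
§5.1; O'Neill 1995, Ch. 2. [cite: ONeill1995, Ch. 2] -/
def region (a r₀ : ℝ) : Opens E4 :=
  ⟨{x | max r₀ 0 < radius a x}, isOpen_lt continuous_const (continuous_radius a)⟩

/-- Membership in `Kerr.region` (Dafermos–Rodnianski arXiv:0811.0354, §5.1). [cite: arXiv08110354] -/
@[simp]
theorem mem_region {a r₀ : ℝ} {x : E4} : x ∈ region a r₀ ↔ max r₀ 0 < radius a x := Iff.rfl

/-- Points of `Kerr.region a r₀` have `r > 0` (Dafermos–Rodnianski arXiv:0811.0354, §5.1). [cite: arXiv08110354] -/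
theorem radius_pos_of_mem_region {a r₀ : ℝ} {x : E4} (hx : x ∈ region a r₀) :
    0 < radius a x :=
  (le_max_right r₀ 0).trans_lt hx

/-- Points of `Kerr.region a r₀` have `r > r₀` (Dafermos–Rodnianski arXiv:0811.0354, §5.1). [cite: arXiv08110354] -/
theorem lt_radius_of_mem_region {a r₀ : ℝ} {x : E4} (hx : x ∈ region a r₀) :
    r₀ < radius a x :=
  (le_max_left r₀ 0).trans_lt hx

/-- The regions are antitone in the inner radius (Dafermos–Rodnianski arXiv:0811.0354, §5.1). [cite: arXiv08110354] -/
theorem region_mono (a : ℝ) {r₀ r₀' : ℝ} (h : r₀ ≤ r₀') : region a r₀' ≤ region a r₀ :=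
  fun _ hx ↦ (max_le_max h le_rfl).trans_lt hx

/-- `Kerr.region a r₀` is nonempty and connected for **all** `a, r₀`: it is diffeomorphic to
`ℝ × (max r₀ 0, ∞) × S²` via `(t*, r, θ, φ)` (the level sets `{r = c}`, `c > 0`, are the
confocal ellipsoids `(x² + y²)/(c² + a²) + z²/c² = 1`). O'Neill 1995, Ch. 2, §2.1;
Dafermos–Rodnianski arXiv:0811.0354, §5.1. Named fact (D-0014), a field of `Kerr.Facts`. [cite: ONeill1995, Ch. 2  §2.1] -/
def isConnected_region (a r₀ : ℝ) : Prop := IsConnected (region a r₀ : Set E4)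

/-- The **Kerr exterior** (domain of outer communications in ingoing Kerr–Schild coordinates)
`{r > r₊} = Kerr.region a r₊` (for subextremal parameters; for other parameters it is just the
chart domain `{r > max r₊ 0}`). **Puncture:** for `M = a = 0`, `r = ‖x⃗‖` and `r₊ = 0`, so
`Kerr.exterior 0 0 = E4 ∖ {time axis}` — this is *not* Minkowski space, which is
`Minkowski.spacetime`. Dafermos–Rodnianski arXiv:0811.0354, §5.1; O'Neill 1995, Ch. 2, §2.4
(Boyer–Lindquist block I). [cite: ONeill1995, Ch. 2  §2.4 (Boyer–Lindquist block I] -/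
def exterior (M a : ℝ) : Opens E4 := region a (rPlus M a)

/-- Membership in the Kerr exterior (Dafermos–Rodnianski arXiv:0811.0354, §5.1). [cite: arXiv08110354] -/
@[simp]
theorem mem_exterior {M a : ℝ} {x : E4} : x ∈ exterior M a ↔ max (rPlus M a) 0 < radius a x :=
  Iff.rfl

/-- The **black hole interior** covered by the ingoing chart: `{r₋ < r ≤ r₊}` (Boyer–Lindquist
block II together with the future event horizon `H⁺ = {r = r₊}`, its outer boundary piece). The
past event horizon and the bifurcation sphere are **not** covered by ingoing Kerr–Schild
coordinates. O'Neill 1995, Ch. 2, §2.4–2.5; Dafermos–Rodnianski arXiv:0811.0354, §5.1. [cite: ONeill1995, Ch. 2  §2.4–2.5] -/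
def blackHoleInterior (M a : ℝ) : Set E4 :=
  {x | rMinus M a < radius a x ∧ radius a x ≤ rPlus M a}

/-- The **future event horizon** `H⁺ = {r = r₊}` in the ingoing chart (O'Neill 1995, Ch. 2,
§2.5; Dafermos–Rodnianski arXiv:0811.0354, §5.1). [cite: ONeill1995, Ch. 2  §2.5] -/
def futureEventHorizon (M a : ℝ) : Set E4 := {x | radius a x = rPlus M a}

/-- The **ergoregion** `{x ∈ exterior | g(∂_{t*}, ∂_{t*}) > 0}`: the part of the exterior where
the stationary Killing field `∂_{t*}` is spacelike (`g_{tt} = −1 + 2H > 0`, i.e.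
`r² + a² cos²θ < 2Mr`). O'Neill 1995, Ch. 2, §2.4; Visser arXiv:0706.0622, §6. [cite: ONeill1995, Ch. 2  §2.4] -/
def ergoregion (M a : ℝ) : Set E4 :=
  {x | x ∈ exterior M a ∧ 0 < bilin M a x (E4.basisVector 0) (E4.basisVector 0)}

/-- The ergoregion lies in the exterior (O'Neill 1995, Ch. 2, §2.4). [cite: ONeill1995, Ch. 2  §2.4] -/
theorem ergoregion_subset_exterior (M a : ℝ) : ergoregion M a ⊆ (exterior M a : Set E4) :=
  fun _ hx ↦ hx.1

/-! ### The Kerr metric, time orientation and spacetime -/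

/-- The section `x ↦ g_{M,a}(x)` of the bundle of bilinear forms on `T(Kerr.region a r₀)` is
real-analytic: `r` is analytic and positive on `{r > 0}` (simple root of the quartic), and `H`,
`ℓ` are rational in `(x, r)` with nonvanishing denominators there. Kerr–Schild 1965;
Visser arXiv:0706.0622, (33)–(35). True for all real `M, a, r₀`. Named fact (D-0014), a field of
`Kerr.Facts`. [cite: KerrSchild1965, §3; Visser arXiv:0706.0622 (33)–(35)] -/
def contMDiff_bilin (M a r₀ : ℝ) : Prop :=
    ContMDiff 𝓘(ℝ, E4) (𝓘(ℝ, E4).prod 𝓘(ℝ, E4 →L[ℝ] E4 →L[ℝ] ℝ)) ω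
      (fun x : region a r₀ ↦ TotalSpace.mk' (E4 →L[ℝ] E4 →L[ℝ] ℝ)
        (E := fun y : region a r₀ ↦
          TangentSpace 𝓘(ℝ, E4) y →L[ℝ] TangentSpace 𝓘(ℝ, E4) y →L[ℝ] ℝ)
        x (bilin M a x.1))

/-- The vector field `x ↦ V(x) = −g♯(dt*)` is a real-analytic section of `T(Kerr.region a r₀)`
(its components `(1 + 2H, −2H ℓ₁, −2H ℓ₂, −2H ℓ₃)` are analytic on `{r > 0}`).
Dafermos–Rodnianski arXiv:0811.0354, §5.1. True for all real `M, a, r₀`. Named fact (D-0014), a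
field of `Kerr.Facts`. [cite: arXiv08110354, §5.1] -/
def contMDiff_timeVector (M a r₀ : ℝ) : Prop :=
    ContMDiff 𝓘(ℝ, E4) 𝓘(ℝ, E4).tangent ω
      (fun x : region a r₀ ↦
        (TotalSpace.mk' E4 x (timeVector M a x.1) : TangentBundle 𝓘(ℝ, E4) (region a r₀)))

/-- The analytic and topological facts about the ingoing Kerr–Schild chart that are vendored as
named facts (D-0014) and on which the bundled Kerr metric / spacetime depend: connectedness of
the chart domains `Kerr.region a r₀` (O'Neill 1995, Ch. 2, §2.1) and real-analyticity of the
sections `x ↦ g_{M,a}(x)` (Kerr–Schild 1965) and `x ↦ V(x) = −g♯(dt*)` (Dafermos–Rodnianski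
arXiv:0811.0354, §5.1), for all real `M, a, r₀`. A `Prop`-valued class, taken as the instance hypothesis `[Kerr.Facts]` (house pattern:
`SphereEmbedding.SmoothnessFacts`, `HodgeTensorFacts`) by
`Kerr.metric`, `Kerr.timeOrientation`, `Kerr.spacetime`, `Kerr.exteriorSpacetime`,
`Schwarzschild.exteriorSpacetime`. [cite: KerrSchild1965, §3; O'Neill 1995 Ch. 2 §2.1] -/
class Facts : Prop where
  /-- `Kerr.region a r₀` is connected (named fact `Kerr.isConnected_region`). -/
  isConnected_region (a r₀ : ℝ) : Kerr.isConnected_region a r₀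
  /-- `x ↦ g_{M,a}(x)` is an analytic section (named fact `Kerr.contMDiff_bilin`). -/
  contMDiff_bilin (M a r₀ : ℝ) : Kerr.contMDiff_bilin M a r₀
  /-- `x ↦ V(x)` is an analytic section (named fact `Kerr.contMDiff_timeVector`). -/
  contMDiff_timeVector (M a r₀ : ℝ) : Kerr.contMDiff_timeVector M a r₀

/-- `Kerr.region a r₀` is a connected space, from the named fact `isConnected_region` (field of
`[Kerr.Facts]`). O'Neill 1995, Ch. 2, §2.1. [cite: ONeill1995, Ch. 2  §2.1] -/
theorem connectedSpace_region [Facts] (a r₀ : ℝ) : ConnectedSpace (region a r₀) :=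
  isConnected_iff_connectedSpace.mp (Facts.isConnected_region a r₀)

/-- The **Kerr metric** `g_{M,a}` with parameters `M` (mass) and `a` (angular momentum per unit
mass) on the chart domain `Kerr.region a r₀ = {r > max r₀ 0}`, as an analytic Lorentzian metric
in ingoing Kerr–Schild Cartesian coordinates: `g = η + 2H ℓ ⊗ ℓ`. Defined for all real
`M, a, r₀`; `a = 0` is Schwarzschild, `M = 0` is (punctured) Minkowski. Kerr, PRL 11 (1963);
Kerr–Schild 1965; O'Neill 1995, Ch. 2; Dafermos–Rodnianski arXiv:0811.0354, §5.1. The analyticity of the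
section is the hypothesis `[Kerr.Facts]` (named fact `contMDiff_bilin`). [cite: KerrSchild1965] -/
def metric [Facts] (M a r₀ : ℝ) : LorentzianMetric 𝓘(ℝ, E4) ω (region a r₀) where
  val x := bilin M a x.1
  symm x := bilin_symm M a x.1
  nondegenerate x := bilin_nondegenerate M a (radius_pos_of_mem_region x.2)
  contMDiff := Facts.contMDiff_bilin M a r₀
  exists_timelike x := bilin_exists_timelike M a (radius_pos_of_mem_region x.2)
  pos_of_orthogonal x := bilin_pos_of_orthogonal M a (radius_pos_of_mem_region x.2)

/-- The Kerr metric at `x` is the Kerr–Schild bilinear form `Kerr.bilin M a x`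
(Kerr–Schild 1965). [cite: KerrSchild1965] -/
@[simp]
theorem metric_val [Facts] (M a r₀ : ℝ) (x : region a r₀) :
    (metric M a r₀).val x = bilin M a x.1 :=
  rfl

/-- The **time orientation** of the Kerr chart for `M ≥ 0`: the analytic timelike vector field
`V = −g♯(dt*) = (1 + 2H, −2H ℓ₁, −2H ℓ₂, −2H ℓ₃)`, `g(V, V) = −1 − 2H < 0` (this needs `H ≥ 0`,
i.e. `0 ≤ M`; for `M < 0` it fails near small `r`). It is future-directed in the sense that
`g(V, ∂_{t*}) = −1 < 0`. Dafermos–Rodnianski arXiv:0811.0354, §5.1; O'Neill 1995, Ch. 2. The analyticity of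
`V` is the hypothesis `[Kerr.Facts]` (named fact `contMDiff_timeVector`). [cite: ONeill1995, Ch. 2] -/
def timeOrientation [Facts] (M a r₀ : ℝ) (hM : 0 ≤ M) : TimeOrientation (metric M a r₀) where
  vectorField x := timeVector M a x.1
  isTimelike x := bilin_timeVector_timeVector_neg hM a (radius_pos_of_mem_region x.2)
  contMDiff := Facts.contMDiff_timeVector M a r₀

/-- **gr.S17** (Kerr family; Kerr PRL 11 (1963), O'Neill 1995 Ch. 2, Dafermos–Rodnianski
arXiv:0811.0354 §5.1). The **Kerr spacetime** `(Kerr.region a r₀, g_{M,a})` with mass `M ≥ 0`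
and specific angular momentum `a`, on the ingoing Kerr–Schild chart domain `{r > max r₀ 0}`,
time-oriented by `−g♯(dt*)`, as a bundled `Spacetime 4` (connected by the named fact
`isConnected_region`, a field of the instance hypothesis `[Kerr.Facts]`).
`r₀ = r₊` gives the exterior (`Kerr.exteriorSpacetime`), `r₀ < r₊` a horizon-penetrating
extension; `a = 0` is Schwarzschild; sub-extremality is `Kerr.IsSubextremal`, the horizon radii
are `Kerr.rPlus`/`Kerr.rMinus`, the ergoregion is `Kerr.ergoregion`. [cite: ONeill1995, Ch. 2  Dafermos–Rodnianski arXiv:0811.03] -/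
def spacetime [Facts] (M a r₀ : ℝ) (hM : 0 ≤ M) : Spacetime 4 where
  carrier := region a r₀
  connectedSpace := connectedSpace_region a r₀
  metric := (metric M a r₀).ofLE le_top
  timeOrientation := (timeOrientation M a r₀ hM).ofLE le_top

/-- The carrier of the Kerr spacetime is the chart domain `Kerr.region a r₀`
(Dafermos–Rodnianski arXiv:0811.0354, §5.1). [cite: arXiv08110354] -/
theorem spacetime_carrier [Facts] (M a r₀ : ℝ) (hM : 0 ≤ M) :
    (spacetime M a r₀ hM).carrier = region a r₀ := rfl

/-- **gr.S17** (Kerr exterior / domain of outer communications; Dafermos–Rodnianski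
arXiv:0811.0354 §5.1, O'Neill 1995 Ch. 2 §2.4). The **Kerr exterior spacetime**
`({r > r₊}, g_{M,a})` for `M ≥ 0`, i.e. `Kerr.spacetime M a r₊`. For subextremal `(M, a)` this
is the domain of outer communications; see `Kerr.exterior` for the puncture at `M = a = 0`;
`[Kerr.Facts]` as in `Kerr.spacetime`. [cite: ONeill1995, Ch. 2 §2.4] -/
def exteriorSpacetime [Facts] (M a : ℝ) (hM : 0 ≤ M) : Spacetime 4 :=
  spacetime M a (rPlus M a) hM

end Kerr

/-- **gr.S17** (Schwarzschild exterior; Schwarzschild 1916, O'Neill 1995 Ch. 2,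
Dafermos–Rodnianski arXiv:0811.0354 §5.1). The **Schwarzschild exterior spacetime** of mass
`M ≥ 0`: the Kerr exterior with `a = 0`, i.e. `{‖x⃗‖ > 2M}` with
`g = η + (2M/r) ℓ ⊗ ℓ`, `ℓ = (1, x⃗/r)` (ingoing Eddington–Finkelstein form); `[Kerr.Facts]` as in
`Kerr.spacetime`. [cite: Schwarzschild1916, O'Neill 1995 Ch. 2  Dafermos–Rodnianski] -/
def Schwarzschild.exteriorSpacetime [Kerr.Facts] (M : ℝ) (hM : 0 ≤ M) : Spacetime 4 :=
  Kerr.exteriorSpacetime M 0 hM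

namespace Kerr

/-! ### Vacuum equations and Killing fields -/

/-- The Kerr metric is **Ricci-flat** (a solution of the Einstein vacuum equations) on the whole
chart domain `{r > max r₀ 0}`, for all real `M, a, r₀`. Kerr, PRL 11 (1963); Kerr–Schild 1965,
§3; O'Neill 1995, Ch. 2, Thm. 2.6.1. Named fact (D-0014); it binds the standing hypothesis
`[(metric M a r₀).HasLeviCivita]` of the curvature API, and states Ricci-flatness as
`∀ x, Ric_x = 0`, i.e. `PseudoRiemannianMetric.IsRicciFlat` (`Einstein.lean`) unfolded by its
definition, so that this file does not import `Einstein.lean`. [cite: KerrSchild1965, §3] -/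
def isRicciFlat [Facts] (M a r₀ : ℝ) : Prop :=
  ∀ [(metric M a r₀).HasLeviCivita], ∀ x : region a r₀, (metric M a r₀).ricci x = 0

/-- The **stationary Killing field** `∂_{t*}` of the Kerr chart (constant components
`(1, 0, 0, 0)`; timelike exactly outside the ergoregion). O'Neill 1995, Ch. 2, §2.2;
Dafermos–Rodnianski arXiv:0811.0354, §5.1. [cite: ONeill1995, Ch. 2  §2.2] -/
def stationaryField (a r₀ : ℝ) : Π x : region a r₀, TangentSpace 𝓘(ℝ, E4) x :=
  fun _ ↦ E4.basisVector 0

/-- The **axial Killing field** `∂_φ = x₁ ∂₂ − x₂ ∂₁` of the Kerr chart (rotations about the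
`z`-axis). O'Neill 1995, Ch. 2, §2.2; Dafermos–Rodnianski arXiv:0811.0354, §5.1. [cite: ONeill1995, Ch. 2  §2.2] -/
def axialField (a r₀ : ℝ) : Π x : region a r₀, TangentSpace 𝓘(ℝ, E4) x :=
  fun x ↦ (x.1 1) • E4.basisVector 2 - (x.1 2) • E4.basisVector 1

/-- `∂_{t*}` is a Killing field of the Kerr metric (the components of `g` do not depend on
`t*`). O'Neill 1995, Ch. 2, §2.2; Kerr–Schild 1965. Named fact (D-0014); it binds
`[(metric M a r₀).HasLeviCivita]`. [cite: ONeill1995, Ch. 2  §2.2] -/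
def isKillingField_stationaryField [Facts] (M a r₀ : ℝ) : Prop :=
  ∀ [(metric M a r₀).HasLeviCivita],
    (metric M a r₀).toPseudoRiemannianMetric.IsKillingField (stationaryField a r₀)

/-- `∂_φ = x₁ ∂₂ − x₂ ∂₁` is a Killing field of the Kerr metric (axisymmetry).
O'Neill 1995, Ch. 2, §2.2; Kerr–Schild 1965. Named fact (D-0014); it binds
`[(metric M a r₀).HasLeviCivita]`. [cite: ONeill1995, Ch. 2  §2.2] -/
def isKillingField_axialField [Facts] (M a r₀ : ℝ) : Prop :=
  ∀ [(metric M a r₀).HasLeviCivita],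
    (metric M a r₀).toPseudoRiemannianMetric.IsKillingField (axialField a r₀)

/-- The stationary field `∂_{t*}` is spacelike exactly on the ergoregion:
`x ∈ ergoregion ↔ 0 < g(∂_{t*}, ∂_{t*})` for `x` in the exterior (O'Neill 1995, Ch. 2, §2.4). [cite: ONeill1995, Ch. 2  §2.4] -/
theorem mem_ergoregion_iff [Facts] {M a : ℝ} (x : exterior M a) :
    x.1 ∈ ergoregion M a ↔
      0 < (metric M a (rPlus M a)).val x (stationaryField a _ x) (stationaryField a _ x) :=
  ⟨fun h ↦ h.2, fun h ↦ ⟨x.2, h⟩⟩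

end Kerr

end Literature.Geometry.Lorentzian

end
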